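import Literature.Analysis.FluidPDE.KNSSTypeIIZoomIn
import Literature.Analysis.FluidPDE.KNSSTypeIRateMildProofs
import Literature.Analysis.FluidPDE.KNSSTypeIRateLimit
import Literature.Analysis.FluidPDE.KNSSTypeIRateLiouvilleHolds
import Literature.Analysis.FluidPDE.AncientMildCompactness
import Literature.Analysis.FluidPDE.BoundedMildSmoothRemainder
import Literature.Analysis.FluidPDE.NSLerayOseenRepresentation
import Literature.Analysis.FluidPDE.NSBoundedMildOseenRestart
import Literature.Analysis.FluidPDE.NSBoundedMildSmoothing
import Literature.Analysis.FluidPDE.KNSSAxisymmetricNoSwirlHolds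
import Summits.NavierStokesRegularity.NavierStokesRegularity.Theorems.CertifiedBlowupCertifiedBlowupAxisymBlowupSwirlPersists
import Summits.NavierStokesRegularity.NavierStokesRegularity.Theorems.CertifiedBlowupCertifiedBlowupAxisymBlowupSwirlOrderParameter
import HarnessLib

/-!
# Extraction of the sup-zoom limit with non-triviality at the marked point

Theorems file landed `--supports stmt-NavierStokesRegularity-0727` (crux `CertifiedBlowupAxisymBlowup`), line
`compact-amplification` (registered), sub-skeleton "axis-aware KNSS sup-zoom of a witness"
(`Cruxes/CertifiedBlowupAxisymBlowup/Lines/registered_zoom_probe.lean`), continuation lead c5.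

This file proves the extraction step `zoom_extract` of the sup-zoom: a sequence of rescaled fields
`V n`, continuous and Oseen-mild on the growing slabs `(A n, B n) × ℝ³` (`A n → −∞`), bounded by
`γ n → 1` up to time `0`, normalised by `‖V n 0 (a n)‖ = 1` at marked points `a n → a₀`, and
uniformly space–time Lipschitz on the window `[−1, 0] × ℝ³`, has a subsequence converging (pointwise
and locally uniformly on every negative slice) to a bounded ancient Oseen-mild field `W` with
`‖W‖ ≤ 1` and `1 − L|s| ≤ ‖W s a₀‖` for `s ∈ (−1, 0)`.  The compactness is the tree's
`KNSS2009_lemma61_oseenMild` (KNSS 2009, Lemma 6.1) applied with the constant bound `2`; the sharp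
bound `‖W‖ ≤ 1` and the non-triviality at `a₀` are limits of the pointwise convergence, the bound
`‖V n‖ ≤ γ n → 1`, and the uniform Lipschitz modulus on the window.

## References
* H. Koch, N. Nadirashvili, G. Seregin, V. Šverák, Acta Math. 203 (2009) 83–105 = arXiv:0709.3599, §4, §6. [KochNadirashviliSereginSverak2009]
-/

set_option linter.dupNamespace false

noncomputable section

open MeasureTheory Set Function Filter Topology Metric
open scoped NNReal ENNReal

namespace Summit.NavierStokesRegularity.NavierStokesRegularity.Theorems.CertifiedBlowupAxisymBlowup.CompactAmplification

open Literature.Analysis Literature.Analysis.FluidPDE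
open Summit.NavierStokesRegularity.NavierStokesRegularity.Theses.CertifiedBlowup

local notation "ℝ³" => EuclideanSpace ℝ (Fin 3)

/-- **Sup-zoom extraction (KNSS 2009, Lemma 6.1 plus the transfer of the normalisation to the
limit).** Let `V n : ℝ → ℝ³ → ℝ³` be continuous on the open slabs `(A n, B n) × ℝ³` with
`A n → −∞`, `A n ≤ −3`, `B n > 0`, with weakly divergence-free slices, satisfying the Oseen
identity `V n t = e^{(t−s)Δ} V n s − B¹_s(V n, V n)(t)` for `A n < s < t ≤ 0`, bounded by
`γ n ≤ 2` on `(A n, 0]` with `γ n → 1`, normalised by `‖V n 0 (a n)‖ = 1` at marked points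
`a n → a₀`, and uniformly Lipschitz in space–time on `[−1, 0] × ℝ³`.  Then a subsequence converges,
pointwise on `(−∞, 0) × ℝ³` and locally uniformly on every negative slice, to a field `W`
continuous on `(−∞, 0) × ℝ³`, with weakly divergence-free slices, `‖W‖ ≤ 1`, satisfying the
ancient Oseen identity for all `s < t < 0`, and non-trivial at the marked point:
`1 − L|s| ≤ ‖W s a₀‖` for `s ∈ (−1, 0)`.  The compactness is
`KNSS2009_lemma61_oseenMild` with the constant bound `2`; the two sharp conclusions are limits
along the pointwise convergence. [cite: KochNadirashviliSereginSverak2009, Lemma 6.1 (arXiv p. 11)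
and the proof of Lemma 6.2 / Thm 6.2 (pp. 12–13), "sup |W| = 1"] -/
theorem zoom_extract : ∀ (A B γ : ℕ → ℝ) (V : ℕ → ℝ → ℝ³ → ℝ³) (a : ℕ → ℝ³) (a₀ : ℝ³) (L : ℝ),
    Tendsto A atTop atBot → (∀ n, A n ≤ -3) → (∀ n, 0 < B n) →
    (∀ n, ContinuousOn (uncurry (V n)) (Ioo (A n) (B n) ×ˢ univ)) →
    (∀ n, ∀ s ∈ Ioo (A n) (B n), IsWeaklyDivFree (V n s)) →
    (∀ n, ∀ s t : ℝ, A n < s → s < t → t ≤ 0 → ∀ x,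
      V n t x = UnboundedOperators.heatExtension (V n s) (t - s) x -
        oseenDuhamel 1 s (V n) (V n) t x) →
    (∀ n, ∀ s ∈ Ioc (A n) 0, ∀ y, ‖V n s y‖ ≤ γ n) → (∀ n, γ n ≤ 2) →
    Tendsto γ atTop (𝓝 1) →
    (∀ n, ‖V n 0 (a n)‖ = 1) → Tendsto a atTop (𝓝 a₀) → 0 ≤ L →
    (∀ n, ∀ s ∈ Icc (-1 : ℝ) 0, ∀ t ∈ Icc (-1 : ℝ) 0, ∀ x y : ℝ³,
      ‖V n t x - V n s y‖ ≤ L * (|t - s| + ‖x - y‖)) →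
    ∃ (φ : ℕ → ℕ) (W : ℝ → ℝ³ → ℝ³), StrictMono φ ∧
      ContinuousOn (uncurry W) (Iio 0 ×ˢ univ) ∧
      (∀ t < 0, ∀ x, ‖W t x‖ ≤ 1) ∧
      (∀ t < 0, IsWeaklyDivFree (W t)) ∧
      (∀ s t : ℝ, s < t → t < 0 → ∀ x,
        W t x = UnboundedOperators.heatExtension (W s) (t - s) x - oseenDuhamel 1 s W W t x) ∧
      (∀ s ∈ Ioo (-1 : ℝ) 0, 1 - L * |s| ≤ ‖W s a₀‖) ∧
      (∀ t < 0, ∀ x, Tendsto (fun j => V (φ j) t x) atTop (𝓝 (W t x))) ∧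
      (∀ t < 0, TendstoLocallyUniformly (fun j => V (φ j) t) (W t) atTop) := by
  intro A B γ V a a₀ L hAlim _hA3 hB hcont hdiv hmild hbdd hγ2 hγ hVa ha _hL hLip
  -- ## Step 1: restrict the hypotheses to the slabs `(A n, 0) × ℝ³`
  have hcont' : ∀ n, ContinuousOn (uncurry (V n)) (Ioo (A n) 0 ×ˢ univ) := fun n =>
    (hcont n).mono (prod_mono (Ioo_subset_Ioo_right (hB n).le) Subset.rfl)
  have hdiv' : ∀ n, ∀ t ∈ Ioo (A n) 0, IsWeaklyDivFree (V n t) := fun n t ht =>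
    hdiv n t ⟨ht.1, ht.2.trans (hB n)⟩
  have hmild' : ∀ n, ∀ s t : ℝ, A n < s → s < t → t < 0 → ∀ x,
      V n t x = UnboundedOperators.heatExtension (V n s) (t - s) x -
        oseenDuhamel 1 s (V n) (V n) t x := fun n s t hs hst ht x =>
    hmild n s t hs hst ht.le x
  have hbdd' : ∀ n, ∀ τ ∈ Ioo (A n) 0, ∀ x, ‖V n τ x‖ ≤ (2 : ℝ) := fun n τ hτ x =>
    (hbdd n τ ⟨hτ.1, hτ.2.le⟩ x).trans (hγ2 n)
  -- ## Step 2: KNSS 2009, Lemma 6.1 with the constant bound `2`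
  obtain ⟨φ, W, hφ, hWc, hWdiv, -, hWmild, -, hpt, hloc⟩ :=
    KNSS2009_lemma61_oseenMild (E := EuclideanSpace ℝ (Fin 3)) (C := (2 : ℝ)) hAlim hcont' hdiv'
      hmild' hbdd'
  refine ⟨φ, W, hφ, hWc, ?_, hWdiv, hWmild, ?_, hpt, hloc⟩
  · -- ## Step 3: the sharp bound `‖W t x‖ ≤ 1` from `‖V (φ j) t x‖ ≤ γ (φ j) → 1`
    intro t ht x
    have h1 : Tendsto (fun j => ‖V (φ j) t x‖) atTop (𝓝 ‖W t x‖) := (hpt t ht x).norm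
    have h2 : Tendsto (fun j => γ (φ j)) atTop (𝓝 1) := hγ.comp hφ.tendsto_atTop
    have hAt : ∀ᶠ j in atTop, A (φ j) < t :=
      (hAlim.comp hφ.tendsto_atTop).eventually (eventually_lt_atBot t)
    exact le_of_tendsto_of_tendsto h1 h2 (hAt.mono fun j hj => hbdd (φ j) t ⟨hj, ht.le⟩ x)
  · -- ## Step 4: non-triviality at the marked point `a₀`
    intro s hs
    have hs1 : s ∈ Icc (-1 : ℝ) 0 := ⟨hs.1.le, hs.2.le⟩
    have h0 : (0 : ℝ) ∈ Icc (-1 : ℝ) 0 := ⟨by norm_num, le_rfl⟩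
    -- the lower bound `1 − L|s| − L‖a n − a₀‖ ≤ ‖V n s a₀‖` for every `n`
    have hlow : ∀ n, 1 - L * |s| - L * ‖a n - a₀‖ ≤ ‖V n s a₀‖ := by
      intro n
      have h01 : ‖V n 0 (a n) - V n s (a n)‖ ≤ L * |s| := by
        have := hLip n s hs1 0 h0 (a n) (a n)
        simpa [sub_self] using this
      have h02 : ‖V n s (a n) - V n s a₀‖ ≤ L * ‖a n - a₀‖ := by
        have := hLip n s hs1 s hs1 (a n) a₀
        simpa [sub_self] using this
      have e1 : ‖V n 0 (a n)‖ - ‖V n s (a n)‖ ≤ L * |s| :=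
        (norm_sub_norm_le _ _).trans h01
      have e2 : ‖V n s (a n)‖ - ‖V n s a₀‖ ≤ L * ‖a n - a₀‖ :=
        (norm_sub_norm_le _ _).trans h02
      rw [hVa n] at e1
      linarith
    -- pass to the limit along `φ`
    have ha' : Tendsto (fun j => ‖a (φ j) - a₀‖) atTop (𝓝 0) :=
      tendsto_iff_norm_sub_tendsto_zero.1 (ha.comp hφ.tendsto_atTop)
    have hlim1 : Tendsto (fun j => 1 - L * |s| - L * ‖a (φ j) - a₀‖) atTop
        (𝓝 (1 - L * |s|)) := by
      have := (tendsto_const_nhds (x := 1 - L * |s|) (f := (atTop : Filter ℕ))).sub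
        (ha'.const_mul L)
      simpa using this
    have hlim2 : Tendsto (fun j => ‖V (φ j) s a₀‖) atTop (𝓝 ‖W s a₀‖) := (hpt s hs.2 a₀).norm
    exact le_of_tendsto_of_tendsto' hlim1 hlim2 fun j => hlow (φ j)

end Summit.NavierStokesRegularity.NavierStokesRegularity.Theorems.CertifiedBlowupAxisymBlowup.CompactAmplification

end
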